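import Summits.CriticalPhenomena.PercolationContinuityZ3.Theorems.Transplant.SkelFrmBParamsCorrKG0
import HarnessLib

/-!
# N2 (frames-only node `SamePDropOfSkeletonFrm₁`, OPEN) — (ζ″) ledger, THE K-G CORRIDOR'S LENGTH BUDGET: closed bounds on p5-g16's step counts
# `m₁ + 1 = ⌊T₁/dec₁⌋`, `m₂ + 1 = max 1 ⌈T₂/dec₂⌉` and the overshoot `X`, the first-step fit `kgFar … 0 ≤ n + 2q + 127R′ + 125ρ + 126|v|` (the input `h0` of
# `KGRows.kgN_spec`), and at the values of record (`ρ := 0`, SkelFrmBParamsCorrKG0) **the (R-34) length budget `NegB.LfQ K₀ := 80·Kcell K₀`** with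
# **`kgSchedN_le_LfQ : kgNv0 + (m₁+1) + (m₂+1) + 1 ≤ LfQ κ.K₀`** (the corridor schedule's `S.N + 1`, `kgCorrSched_params`) and `kgFar_zero_le_kgTgt0` (`h0` discharged).

* §1 (generic, `Skelφ.KGRows.*_budget`, over SkelPhiCorridorKGValues): `kgM₁_budget : 2·sL·(m₁+1) ≤ 3·T₁` under `3(2R′+ρ) ≤ sL`; `kgM₂_budget : (m₂+1)·dec₂ ≤ T₂ + dec₂`
  (no extra floor; `T₂ ≥ 1` from `hq`, `hρv`); `kgX_budget : X ≤ 2X₂ − R′ − ρ` under `4R′ + 3ρ ≤ n`; `kgM₁_zero_le : m₁(0) + 1 ≤ 63` under `W ≤ 21sL`;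
  **`kgFar_zero_budget : kgFar … 0 ≤ n + 2q + 127R′ + 125ρ + 126|v|`**; `kgM₁_succ_budget : 8(m₁+1) ≤ 504 + 3(N+1)` under `W ≤ 21sL`, `8R′ ≤ sL`;
  `kgM₂_succ_budget : 2n(m₂+1) ≤ 6X₂ + 3`; `kgFar_budget`; `le_kgN` (`kgFar M ≤ tgt → M ≤ kgN`, for the root tuple's `K ≤ N+1`); **`kgSchedN_budget : N + 1 + (m₁+1) + (m₂+1) ≤ 80·K`** (`N ≤ 20K+4`, `K ≥ 40`, `q ≤ 42n`).
* §2 (at the values, `ρ := 0`, `PlanarSkeletonFrm.NegB.*`): the residual floors **`KGRes`** (`qx ≤ 40n_L`, `Wx ≤ 20sL`), `kgFar_zero_le_kgTgt0` (`h0`), **`LfQ`**,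
  **`kgSchedN_le_LfQ`**.
builds on p205010 (kernel theorem, internal audit signed; external expert review pending) — nothing in this file uses p205010; NOTHING is claimed about the open
node `SamePDropOfSkeletonFrm₁`.
Lane `prim-bschramm`, seat `prim-bschramm-stmt` (gen 20); helper file (`--supports stmt-CriticalPhenomena-4575 --as helper`); ruling (R-34) (p3-g16 2026-08-23, `Lf` of
record owned by stmt); ledger HOME/prim-bschramm-stmt/FRM-PARAMS.md.
[cite: KozmaNitzan2024, §4 Lemma 12 (pp. 23–25: the corridor's step counts)] [cite: MartineauTassion2017, §4.3 Lemma 4.2 (steering)]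
-/

open scoped Classical

noncomputable section

namespace Summit.CriticalPhenomena.PercolationContinuityZ3.Theorems.Transplant

namespace Skelφ

/-! ## §1 Generic budgets over `KGRows` -/

section Budget

variable {n ℓ : ℕ} {hs v : ℤ} {R' ρ q W : ℕ}

/-- **`2·sL·(m₁+1) ≤ 3·T₁`** under `3(2R′ + ρ) ≤ sL` (then `3·dec₁ ≥ 2·sL`, and `(m₁+1)·dec₁ ≤ T₁`). [this work] -/
theorem KGRows.kgM₁_budget (H : KGRows n ℓ hs v R' ρ q W) (hS : 3 * (2 * (R' : ℤ) + ρ) ≤ kgSL n ℓ hs) (N : ℕ) :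
    2 * kgSL n ℓ hs * ((((kgM₁ n ℓ hs R' ρ W N : ℕ) : ℤ)) + 1) ≤ 3 * kgT₁ R' W N := by
  obtain ⟨he, -⟩ := H.kgM₁_spec N
  have hd := H.dec₁_pos
  have hd0 : 0 < kgDec₁ n ℓ hs R' ρ := by linarith
  have hfl := Int.ediv_mul_le (kgT₁ R' W N) (ne_of_gt hd0)
  rw [← he] at hfl
  have h3 : 2 * kgSL n ℓ hs ≤ 3 * kgDec₁ n ℓ hs R' ρ := by unfold kgDec₁; linarith
  have hm0 : (0 : ℤ) ≤ (((kgM₁ n ℓ hs R' ρ W N : ℕ) : ℤ)) + 1 := by positivity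
  nlinarith

/-- `1 ≤ T₂` (`X₂ ≥ q ≥ n + |v|`, `ρ + |v| ≤ n`). [folklore] -/
theorem KGRows.one_le_kgT₂ (H : KGRows n ℓ hs v R' ρ q W) (N : ℕ) : 1 ≤ kgT₂ n ℓ hs v R' ρ q W N := by
  have hq := H.hq
  have hρv := H.hρv
  have ha : (0 : ℤ) ≤ |v| := abs_nonneg _
  have hm0 : (0 : ℤ) ≤ ((((kgM₁ n ℓ hs R' ρ W N : ℕ) : ℤ)) + 1) * ((R' : ℤ) + ρ + |v|) := by positivity
  have hN0 : (0 : ℤ) ≤ ((N : ℤ) + 1) * R' := by positivity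
  unfold kgT₂ kgX₂
  linarith

/-- **`(m₂+1)·dec₂ ≤ T₂ + dec₂`** (`m₂ + 1 = max 1 ⌈T₂/dec₂⌉`, `T₂ ≥ 1`). [this work] -/
theorem KGRows.kgM₂_budget (H : KGRows n ℓ hs v R' ρ q W) (N : ℕ) :
    ((((kgM₂ n ℓ hs v R' ρ q W N : ℕ) : ℤ)) + 1) * kgDec₂ n R' ρ ≤ kgT₂ n ℓ hs v R' ρ q W N + kgDec₂ n R' ρ := by
  obtain ⟨he, -⟩ := H.kgM₂_spec N
  have hd := H.dec₂_pos.1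
  have hd0 : 0 < kgDec₂ n R' ρ := by linarith
  have hT := H.one_le_kgT₂ N
  rcases le_or_gt ((kgT₂ n ℓ hs v R' ρ q W N + kgDec₂ n R' ρ - 1) / kgDec₂ n R' ρ) 1 with hle | hlt
  · rw [max_eq_left hle] at he
    rw [he]; linarith
  · rw [max_eq_right hlt.le] at he
    have hfl := Int.ediv_mul_le (kgT₂ n ℓ hs v R' ρ q W N + kgDec₂ n R' ρ - 1) (ne_of_gt hd0)
    rw [← he] at hfl
    linarith

/-- **`X ≤ 2·X₂ − R′ − ρ`** under `4R′ + 3ρ ≤ n` (then `2(R′+ρ) ≤ dec₂` and `(m₂+1)(R′+ρ) ≤ (T₂ + dec₂)/2`). [this work] -/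
theorem KGRows.kgX_budget (H : KGRows n ℓ hs v R' ρ q W) (hS₂ : 4 * (R' : ℤ) + 3 * ρ ≤ n) (N : ℕ) :
    kgX n ℓ hs v R' ρ q W N ≤ 2 * kgX₂ n ℓ hs v R' ρ q W N - R' - ρ := by
  have hb := H.kgM₂_budget N
  have hA0 : (0 : ℤ) ≤ (((kgM₂ n ℓ hs v R' ρ q W N : ℕ) : ℤ)) + 1 := by positivity
  have h2 : 2 * ((R' : ℤ) + ρ) ≤ kgDec₂ n R' ρ := by unfold kgDec₂; linarith
  have h3 : 2 * (((((kgM₂ n ℓ hs v R' ρ q W N : ℕ) : ℤ)) + 1) * ((R' : ℤ) + ρ)) ≤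
      ((((kgM₂ n ℓ hs v R' ρ q W N : ℕ) : ℤ)) + 1) * kgDec₂ n R' ρ := by nlinarith
  unfold kgT₂ kgDec₂ at hb
  unfold kgX
  set P := ((((kgM₂ n ℓ hs v R' ρ q W N : ℕ) : ℤ)) + 1) * ((R' : ℤ) + ρ) with hP
  have h4 : 2 * P ≤ 2 * kgX₂ n ℓ hs v R' ρ q W N - 2 * R' - 2 * ρ + 1 := by unfold kgDec₂ at h3; linarith
  omega

/-- **`m₁(0) + 1 ≤ 63`** under `3(2R′+ρ) ≤ sL` and `W ≤ 21·sL`. [this work] -/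
theorem KGRows.kgM₁_zero_le (H : KGRows n ℓ hs v R' ρ q W) (hS : 3 * (2 * (R' : ℤ) + ρ) ≤ kgSL n ℓ hs) (hW2 : (W : ℤ) ≤ 21 * kgSL n ℓ hs) :
    (((kgM₁ n ℓ hs R' ρ W 0 : ℕ) : ℤ)) + 1 ≤ 63 := by
  have hb := H.kgM₁_budget hS 0
  have hsL := H.sL_nonneg
  have hd := H.hR₁
  unfold kgT₁ at hb
  norm_num at hb
  -- 2 sL (m+1) ≤ 6W + 6R′ ≤ 126 sL + 6R′ < 128 sL
  have hρ0 : (0 : ℤ) ≤ ρ := by positivity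
  have hlt : 2 * kgSL n ℓ hs * ((((kgM₁ n ℓ hs R' ρ W 0 : ℕ) : ℤ)) + 1) < 2 * kgSL n ℓ hs * 64 := by linarith
  have hpos : 0 < 2 * kgSL n ℓ hs := by linarith
  have := lt_of_mul_lt_mul_left hlt hpos.le
  linarith

/-- **THE FIRST-STEP FIT**: `kgFar … 0 ≤ n + 2q + 127R′ + 125ρ + 126|v|` under `3(2R′+ρ) ≤ sL`, `4R′ + 3ρ ≤ n`, `W ≤ 21·sL`. [this work] -/
theorem KGRows.kgFar_zero_budget (H : KGRows n ℓ hs v R' ρ q W) (hS : 3 * (2 * (R' : ℤ) + ρ) ≤ kgSL n ℓ hs) (hS₂ : 4 * (R' : ℤ) + 3 * ρ ≤ n)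
    (hW2 : (W : ℤ) ≤ 21 * kgSL n ℓ hs) :
    kgFar n ℓ hs v R' ρ q W 0 ≤ (n : ℤ) + 2 * q + 127 * R' + 125 * ρ + 126 * |v| := by
  have hX := H.kgX_budget hS₂ 0
  have hm := H.kgM₁_zero_le hS hW2
  have hm0 : (0 : ℤ) ≤ (((kgM₁ n ℓ hs R' ρ W 0 : ℕ) : ℤ)) + 1 := by positivity
  have hg0 : (0 : ℤ) ≤ (R' : ℤ) + ρ + |v| := by positivity
  have hprod : ((((kgM₁ n ℓ hs R' ρ W 0 : ℕ) : ℤ)) + 1) * ((R' : ℤ) + ρ + |v|) ≤ 63 * ((R' : ℤ) + ρ + |v|) := by nlinarith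
  unfold kgFar
  unfold kgX₂ at hX
  push_cast at hX ⊢
  linarith

/-- **`8·(m₁+1) ≤ 504 + 3(N+1)`** under `W ≤ 21·sL`, `8R′ ≤ sL` (so `m₁ + 1 ≤ 63 + 3(N+1)/8`). [this work] -/
theorem KGRows.kgM₁_succ_budget (H : KGRows n ℓ hs v R' ρ q W) (hS : 3 * (2 * (R' : ℤ) + ρ) ≤ kgSL n ℓ hs) (hW2 : (W : ℤ) ≤ 21 * kgSL n ℓ hs)
    (hR8 : 8 * (R' : ℤ) ≤ kgSL n ℓ hs) (N : ℕ) :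
    8 * ((((kgM₁ n ℓ hs R' ρ W N : ℕ) : ℤ)) + 1) ≤ 504 + 3 * ((N : ℤ) + 1) := by
  have hb := H.kgM₁_budget hS N
  have hd := H.hR₁
  have hρ0 : (0 : ℤ) ≤ ρ := by positivity
  have hpos : 0 < kgSL n ℓ hs := by linarith
  unfold kgT₁ at hb
  have hN0 : (0 : ℤ) ≤ (N : ℤ) + 1 := by positivity
  -- 2 sL (m+1) ≤ 6W + 6(N+1)R′ ≤ 126 sL + 6(N+1)·sL/8
  have h1 : 8 * (2 * kgSL n ℓ hs * ((((kgM₁ n ℓ hs R' ρ W N : ℕ) : ℤ)) + 1)) ≤ kgSL n ℓ hs * (1008 + 6 * ((N : ℤ) + 1)) := by nlinarith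
  have h2 : kgSL n ℓ hs * (16 * ((((kgM₁ n ℓ hs R' ρ W N : ℕ) : ℤ)) + 1)) ≤ kgSL n ℓ hs * (1008 + 6 * ((N : ℤ) + 1)) := by linarith
  have := le_of_mul_le_mul_left h2 hpos
  linarith

/-- **`2n·(m₂+1) ≤ 6·X₂ + 3`** under `3(2R′+ρ) ≤ n` (then `3·dec₂ ≥ 2n`). [this work] -/
theorem KGRows.kgM₂_succ_budget (H : KGRows n ℓ hs v R' ρ q W) (hS₂ : 3 * (2 * (R' : ℤ) + ρ) ≤ n) (N : ℕ) :
    2 * (n : ℤ) * ((((kgM₂ n ℓ hs v R' ρ q W N : ℕ) : ℤ)) + 1) ≤ 6 * kgX₂ n ℓ hs v R' ρ q W N + 3 := by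
  have hb := H.kgM₂_budget N
  have hd := H.dec₂_pos.1
  have hd0 : 0 < kgDec₂ n R' ρ := by linarith
  have hA0 : (0 : ℤ) ≤ (((kgM₂ n ℓ hs v R' ρ q W N : ℕ) : ℤ)) + 1 := by positivity
  have h3 : 2 * (n : ℤ) ≤ 3 * kgDec₂ n R' ρ := by unfold kgDec₂; linarith
  have hρ0 : (0 : ℤ) ≤ ρ := by positivity
  have h4 : 2 * (n : ℤ) * ((((kgM₂ n ℓ hs v R' ρ q W N : ℕ) : ℤ)) + 1) ≤ 3 * (((((kgM₂ n ℓ hs v R' ρ q W N : ℕ) : ℤ)) + 1) * kgDec₂ n R' ρ) := by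
    nlinarith
  unfold kgT₂ at hb
  have h5 : kgDec₂ n R' ρ ≤ n := by unfold kgDec₂; linarith
  nlinarith

/-- **The far edge after `N` run steps**: `kgFar … N ≤ (N+1)n + 2q + 2(N+1)R′ + 2(m₁+1)(R′+ρ+|v|) − R′ − ρ` under `4R′ + 3ρ ≤ n`. [this work] -/
theorem KGRows.kgFar_budget (H : KGRows n ℓ hs v R' ρ q W) (hS₂ : 4 * (R' : ℤ) + 3 * ρ ≤ n) (N : ℕ) :
    kgFar n ℓ hs v R' ρ q W N ≤ ((N : ℤ) + 1) * n + 2 * q + 2 * (((N : ℤ) + 1) * R') +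
      2 * (((((kgM₁ n ℓ hs R' ρ W N : ℕ) : ℤ)) + 1) * ((R' : ℤ) + ρ + |v|)) - R' - ρ := by
  have hX := H.kgX_budget hS₂ N
  unfold kgFar
  unfold kgX₂ at hX
  linarith

/-- **A run of `M` steps that fits is below the run length of record**: `kgFar … M ≤ tgt → M ≤ kgN … tgt` (`Nat.le_findGreatest`; the root tuple's
`K ≤ N + 1`). [this work] -/
theorem KGRows.le_kgN (H : KGRows n ℓ hs v R' ρ q W) {tgt : ℤ} {M : ℕ} (hfit : kgFar n ℓ hs v R' ρ q W M ≤ tgt) :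
    M ≤ kgN n ℓ hs v R' ρ q W tgt := by
  have hn := H.hn
  have hX := kgX_nonneg (n := n) (ℓ := ℓ) (hs := hs) (v := v) (R' := R') (ρ := ρ) (q := q) (W := W) M
  have hfar : ((M : ℤ) + 1) * n ≤ tgt := by unfold kgFar at hfit; linarith
  have hM : M ≤ tgt.toNat / n := by
    apply (Nat.le_div_iff_mul_le (by omega)).2
    have h1 : ((M * n : ℕ) : ℤ) ≤ tgt := by push_cast; nlinarith
    have h2 : ((M * n : ℕ) : ℤ) ≤ (tgt.toNat : ℤ) := h1.trans (Int.self_le_toNat tgt)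
    exact_mod_cast h2
  unfold kgN
  exact Nat.le_findGreatest (P := fun N => kgFar n ℓ hs v R' ρ q W N ≤ tgt) hM hfit

/-- **THE LENGTH BUDGET, generic**: `N + 1 + (m₁+1) + (m₂+1) ≤ 80·K` whenever `N ≤ 20K + 4`, `K ≥ 40`, under the floors `3(2R′+ρ) ≤ sL`, `3(2R′+ρ) ≤ n`,
`8R′ ≤ sL`, `W ≤ 21·sL`, `q ≤ 42·n`. [this work] -/
theorem KGRows.kgSchedN_budget (H : KGRows n ℓ hs v R' ρ q W) (hS : 3 * (2 * (R' : ℤ) + ρ) ≤ kgSL n ℓ hs) (hSn : 3 * (2 * (R' : ℤ) + ρ) ≤ n)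
    (hR8 : 8 * (R' : ℤ) ≤ kgSL n ℓ hs) (hW2 : (W : ℤ) ≤ 21 * kgSL n ℓ hs) (hq6 : (q : ℤ) ≤ 42 * n) {K : ℤ} (hK : 40 ≤ K) (N : ℕ)
    (hNK : (N : ℤ) ≤ 20 * K + 4) :
    (N : ℤ) + 1 + ((((kgM₁ n ℓ hs R' ρ W N : ℕ) : ℤ)) + 1) + ((((kgM₂ n ℓ hs v R' ρ q W N : ℕ) : ℤ)) + 1) ≤ 80 * K := by
  have f1 := H.kgM₁_succ_budget hS hW2 hR8 N
  have f2 := H.kgM₂_succ_budget hSn N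
  have hρv := H.hρv
  have hn1 : (1 : ℤ) ≤ n := by exact_mod_cast H.hn
  have hR0 : (0 : ℤ) ≤ R' := by positivity
  have hρ0 : (0 : ℤ) ≤ ρ := by positivity
  have ha : (0 : ℤ) ≤ |v| := abs_nonneg _
  set a := (((kgM₁ n ℓ hs R' ρ W N : ℕ) : ℤ)) + 1 with ha_def
  set b := (((kgM₂ n ℓ hs v R' ρ q W N : ℕ) : ℤ)) + 1 with hb_def
  have ha0 : 0 ≤ a := by positivity
  have hb0 : 0 ≤ b := by positivity
  have hN0 : (0 : ℤ) ≤ (N : ℤ) + 1 := by positivity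
  -- X₂ = q + (N+1)R′ + a(R′+ρ+|v|)
  have hX₂ : kgX₂ n ℓ hs v R' ρ q W N = (q : ℤ) + ((N : ℤ) + 1) * R' + a * ((R' : ℤ) + ρ + |v|) := by unfold kgX₂; ring
  have g1 : a * ((R' : ℤ) + ρ + |v|) ≤ a * R' + a * n := by nlinarith
  have g2 : 6 * (a * (R' : ℤ)) ≤ a * n := by nlinarith
  have g3 : 6 * (((N : ℤ) + 1) * R') ≤ ((N : ℤ) + 1) * n := by nlinarith
  have g4 : 6 * kgX₂ n ℓ hs v R' ρ q W N ≤ (253 + (N : ℤ) + 7 * a) * n := by rw [hX₂]; nlinarith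
  have g5 : 2 * (n : ℤ) * b ≤ (256 + (N : ℤ) + 7 * a) * n := by nlinarith
  have g6 : 2 * b ≤ 256 + (N : ℤ) + 7 * a := by
    have : (n : ℤ) * (2 * b) ≤ (n : ℤ) * (256 + (N : ℤ) + 7 * a) := by nlinarith
    exact le_of_mul_le_mul_left this (by linarith)
  linarith

end Budget

end Skelφ

/-! ## §2 At the values of record (`ρ := 0`, SkelFrmBParamsCorrKG0): `h0` and the (R-34) length budget `LfQ` -/

namespace PlanarSkeletonFrm

namespace NegB

open Literature.Probability.Percolation Literature.Probability.LatticeModels SimpleGraph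
open SkelConc (Consts)
open Skelφ (shearUnit kgSL kgΔ kgN kgFar kgX₂ kgM₁ kgM₂ KGRows)
open Neg

section Values

variable (κ : Consts) {V : Type} [DecidableEq V] [Countable V] {G : SimpleGraph V} [G.LocallyFinite] (Φ : PlanarSkeletonFrm G) (t : V) (p : unitInterval)
  (D : Skelφ.StepI.DataNS V) (g f mk qx Wx : ℕ)

/-- **The residual floors** of the corridor tuple: `qx ≤ 40·n_L` and `Wx ≤ 20·sL` (room for the start-box rows `haq/hbW`). [this work] -/
structure KGRes : Prop where
  /-- `qx ≤ 40·n_L` -/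
  hqx : qx ≤ 40 * nL κ Φ t p D g f
  /-- `Wx ≤ 20·sL` -/
  hWx : (Wx : ℤ) ≤ 20 * kgSL (nL κ Φ t p D g f) (ℓL κ Φ t p D g f) (hL κ Φ t p D g f)

/-- The generic floors at the values (`ρ := 0`): `3(2R′+0) ≤ sL`, `3(2R′+0) ≤ n_L`, `4R′+3·0 ≤ n_L`, `8R′ ≤ sL`, and `W ≤ 21·sL` under `Wx ≤ 20·sL`. [folklore] -/
theorem kg_floors (hN : EqNumL κ Φ t p D g f) (hg : gFloorKG κ Φ t p D mk ≤ g)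
    (hWx : (Wx : ℤ) ≤ 20 * kgSL (nL κ Φ t p D g f) (ℓL κ Φ t p D g f) (hL κ Φ t p D g f)) :
    3 * (2 * ((kgR κ Φ t p D mk : ℕ) : ℤ) + ((0 : ℕ) : ℤ)) ≤ kgSL (nL κ Φ t p D g f) (ℓL κ Φ t p D g f) (hL κ Φ t p D g f) ∧
    3 * (2 * ((kgR κ Φ t p D mk : ℕ) : ℤ) + ((0 : ℕ) : ℤ)) ≤ (nL κ Φ t p D g f : ℤ) ∧
    4 * ((kgR κ Φ t p D mk : ℕ) : ℤ) + 3 * ((0 : ℕ) : ℤ) ≤ (nL κ Φ t p D g f : ℤ) ∧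
    8 * ((kgR κ Φ t p D mk : ℕ) : ℤ) ≤ kgSL (nL κ Φ t p D g f) (ℓL κ Φ t p D g f) (hL κ Φ t p D g f) ∧
    ((kgW κ Φ t p D g f Wx : ℕ) : ℤ) ≤ 21 * kgSL (nL κ Φ t p D g f) (ℓL κ Φ t p D g f) (hL κ Φ t p D g f) := by
  have hnle := hN.n_le
  have hgML : g ≤ ML κ Φ t p D g := (ML_le_ML κ Φ t p D g).2
  have hsL := ML_sub_one_le_kgSL κ Φ t p D g f hN
  unfold gFloorKG at hg
  have hfl : ((8 * KS0.R'0 κ Φ t p D mk + 3 * Mu D + 6 : ℕ) : ℤ) ≤ ML κ Φ t p D g := by exact_mod_cast hg.trans hgML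
  push_cast at hfl
  unfold kgR kgW
  have hs0 : 0 ≤ kgSL (nL κ Φ t p D g f) (ℓL κ Φ t p D g f) (hL κ Φ t p D g f) := by linarith
  have ht : (((kgSL (nL κ Φ t p D g f) (ℓL κ Φ t p D g f) (hL κ Φ t p D g f)).toNat : ℕ) : ℤ) =
      kgSL (nL κ Φ t p D g f) (ℓL κ Φ t p D g f) (hL κ Φ t p D g f) := Int.toNat_of_nonneg hs0
  have hM0 : (0 : ℤ) ≤ (Mu D : ℤ) := by positivity
  push_cast
  rw [ht]
  refine ⟨by linarith, by linarith, by linarith, by linarith, by linarith⟩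

/-- **`h0` DISCHARGED** (`ρ := 0`): the first run step fits, `kgFar … 0 ≤ kgTgt0`, under `EqNumL`, the box-slot floor and the residual floors. [this work] -/
theorem kgFar_zero_le_kgTgt0 (hN : EqNumL κ Φ t p D g f) (hg : gFloorKG κ Φ t p D mk ≤ g) (hx : KGRes κ Φ t p D g f qx Wx) :
    kgFar (nL κ Φ t p D g f) (ℓL κ Φ t p D g f) (hL κ Φ t p D g f) (vL κ Φ t p D g f) (kgR κ Φ t p D mk) 0 (kgq κ Φ t p D g f qx)
      (kgW κ Φ t p D g f Wx) 0 ≤ kgTgt0 κ Φ t p D g f mk := by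
  have H := kgRows0_of κ Φ t p D g f mk qx Wx hN hg
  obtain ⟨hS, -, hS₂, -, hW2⟩ := kg_floors κ Φ t p D g f mk Wx hN hg hx.hWx
  have hb := H.kgFar_zero_budget hS hS₂ hW2
  have hqx : ((qx : ℕ) : ℤ) ≤ 40 * (nL κ Φ t p D g f : ℤ) := by exact_mod_cast hx.hqx
  have hv := hN.v_le
  have hK := (Skelφ.NegPrm.forty_le_Kcell κ.K₀).1
  have hK' : (40 : ℤ) ≤ (Neg.K κ : ℤ) := by unfold Neg.K; exact_mod_cast hK
  have hn0 : (0 : ℤ) ≤ nL κ Φ t p D g f := by positivity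
  have hpt := (pitch_le_kgTgt0 κ Φ t p D g f mk hN).1
  have hpitch : 800 * (nL κ Φ t p D g f : ℤ) ≤ pitch κ Φ t p D g f := by unfold pitch; nlinarith
  have e1 : ((kgq κ Φ t p D g f qx : ℕ) : ℤ) = 2 * (nL κ Φ t p D g f : ℤ) + qx := by unfold kgq; push_cast; ring
  push_cast at hb hS₂
  linarith

/-- **THE (R-34) LENGTH BUDGET OF RECORD**: `LfQ K₀ := 80·Kcell K₀` (`= 3200·Kq K₀`). [this work] -/
def LfQ (K₀ : ℕ) : ℕ := 80 * Skelφ.NegPrm.Kcell K₀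

/-- `LfQ κ.K₀ = 80·K`. [folklore] -/
theorem LfQ_eq : LfQ κ.K₀ = 80 * Neg.K κ := rfl

/-- **THE CORRIDOR FITS THE BUDGET** (`ρ := 0`): `N + 1 + (m₁+1) + (m₂+1) ≤ LfQ κ.K₀` at the values of record (`(kgCorrSched …).N = N + 1 + m₁ + 1 + m₂`,
`kgCorrSched_params`, so this is `S.N + 1 ≤ LfQ`), under `EqNumL`, the box-slot floor and the residual floors. [this work] -/
theorem kgSchedN_le_LfQ (hN : EqNumL κ Φ t p D g f) (hg : gFloorKG κ Φ t p D mk ≤ g) (hx : KGRes κ Φ t p D g f qx Wx) :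
    kgNv0 κ Φ t p D g f mk qx Wx + 1 +
        (kgM₁ (nL κ Φ t p D g f) (ℓL κ Φ t p D g f) (hL κ Φ t p D g f) (kgR κ Φ t p D mk) 0 (kgW κ Φ t p D g f Wx)
          (kgNv0 κ Φ t p D g f mk qx Wx) + 1) +
        (kgM₂ (nL κ Φ t p D g f) (ℓL κ Φ t p D g f) (hL κ Φ t p D g f) (vL κ Φ t p D g f) (kgR κ Φ t p D mk) 0 (kgq κ Φ t p D g f qx)
          (kgW κ Φ t p D g f Wx) (kgNv0 κ Φ t p D g f mk qx Wx) + 1) ≤ LfQ κ.K₀ := by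
  have H := kgRows0_of κ Φ t p D g f mk qx Wx hN hg
  obtain ⟨hS, hSn, -, hR8, hW2⟩ := kg_floors κ Φ t p D g f mk Wx hN hg hx.hWx
  have hNle := kgNv0_le κ Φ t p D g f mk qx Wx hN hg
  have hK := (Skelφ.NegPrm.forty_le_Kcell κ.K₀).1
  have hK' : (40 : ℤ) ≤ (Neg.K κ : ℤ) := by unfold Neg.K; exact_mod_cast hK
  have hNz : ((kgNv0 κ Φ t p D g f mk qx Wx : ℕ) : ℤ) ≤ 20 * (Neg.K κ : ℤ) + 4 := by exact_mod_cast hNle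
  have hq6 : ((kgq κ Φ t p D g f qx : ℕ) : ℤ) ≤ 42 * (nL κ Φ t p D g f : ℤ) := by
    have hqx : qx ≤ 40 * nL κ Φ t p D g f := hx.hqx
    unfold kgq; push_cast
    have : ((qx : ℕ) : ℤ) ≤ 40 * (nL κ Φ t p D g f : ℤ) := by exact_mod_cast hqx
    linarith
  have hb := H.kgSchedN_budget hS hSn hR8 hW2 hq6 hK' (kgNv0 κ Φ t p D g f mk qx Wx) hNz
  have hZ : ((kgNv0 κ Φ t p D g f mk qx Wx + 1 +
        (kgM₁ (nL κ Φ t p D g f) (ℓL κ Φ t p D g f) (hL κ Φ t p D g f) (kgR κ Φ t p D mk) 0 (kgW κ Φ t p D g f Wx)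
          (kgNv0 κ Φ t p D g f mk qx Wx) + 1) +
        (kgM₂ (nL κ Φ t p D g f) (ℓL κ Φ t p D g f) (hL κ Φ t p D g f) (vL κ Φ t p D g f) (kgR κ Φ t p D mk) 0 (kgq κ Φ t p D g f qx)
          (kgW κ Φ t p D g f Wx) (kgNv0 κ Φ t p D g f mk qx Wx) + 1) : ℕ) : ℤ) ≤ ((LfQ κ.K₀ : ℕ) : ℤ) := by
    rw [LfQ_eq]; push_cast; linarith
  exact_mod_cast hZ

end Values

end NegB

end PlanarSkeletonFrm

end Summit.CriticalPhenomena.PercolationContinuityZ3.Theorems.Transplant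

end
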